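import Summits.Langlands.Langlands.Theorems.TatePhantomLift
import Summits.Langlands.Langlands.Theorems.TwinRigiditySplitPrelude

/-!
# `CliffordOrbitSplitPrelude` — lens-4 g31 node `CliffordOrbitSplit`, landing part 1/2 (pure support, 0 sorry):
# §1 the EXTREMAL LEMMA «a finite group with no normal subgroup of prime index has no subgroup of index 2, 3 or 4» (coset action into `S₄`, sign,
# `V₄ ◁ A₄` by `decide` on `Perm (Fin 4)`) with its Galois corollary (no intermediate field of degree `≤ 4` in a layer without cyclic prime sub-layers), and
# §2 the change-of-frame algebra of the CLIFFORD ACTION of `Γ_K` on the centre of the commutant of a `Γ_K`-invariant representation of `Γ_L`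
# (well-defined: `act_eq_of_isIntertwiner`; trivial on `res Γ_L`: `act_eq_self_of_absGaloisRestrict`; exists for relative avatars: `isIntertwiner_exists`).

Part 2 (`Theorems/CliffordOrbitSplit.lean`) holds the pieces KRON / STAB / MOV of the residual RED° = stmt-Langlands-27357 `Theses.PerfectLayerClifford.ReduciblePerfectDescent`,
the kernel `closes_target : KRON → STAB → MOV → RED°` BY NAME, exactness `red_iff_pieces`, the decided rung `movingAt_of_le_four` and the host edges; mechanism / novelty /
weaker-than-S discussion: module docstring of part 2 (= node card HOME/decomp-langlands-lens-4/g31/CliffordOrbitSplit.md on the decomp-langlands bus).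
-/


set_option linter.dupNamespace false
set_option linter.unusedVariables false
set_option linter.style.longLine false
set_option linter.unusedSectionVars false

namespace Summit.Langlands.Langlands.Theorems.CliffordOrbitSplit

open scoped BigOperators Topology Matrix Classical
open Filter Set Function
open Literature.NumberTheory.GaloisRepresentations Literature.NumberTheory.Automorphic
open IsDedekindDomain
open Summit.Langlands.Langlands.Theses
open Summit.Langlands.Langlands.Theorems.TatePhantomLift (relAvatar_invariant perfect_of_langlands conj_conj conj_one)
open Summit.Langlands.Langlands.Theorems.TwinRigiditySplit (no_normal_subgroup_of_prime_index)
open scoped NumberField Polynomial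
open Equiv Equiv.Perm

/-! ## §1 The extremal lemma: a finite group without normal subgroups of prime index has no subgroup of index 2, 3 or 4 -/

/-- The double transposition `(0 1)(2 3)`. -/
def dt1 : Perm (Fin 4) := swap 0 1 * swap 2 3
/-- The double transposition `(0 2)(1 3)`. -/
def dt2 : Perm (Fin 4) := swap 0 2 * swap 1 3
/-- The double transposition `(0 3)(1 2)`. -/
def dt3 : Perm (Fin 4) := swap 0 3 * swap 1 2

/-- The Klein four-group `V₄ ≤ S₄`. -/
def kleinFour : Subgroup (Perm (Fin 4)) where
  carrier := {1, dt1, dt2, dt3}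
  one_mem' := Or.inl rfl
  mul_mem' := by
    intro a b ha hb
    simp only [Set.mem_insert_iff, Set.mem_singleton_iff] at ha hb ⊢
    rcases ha with rfl | rfl | rfl | rfl <;> rcases hb with rfl | rfl | rfl | rfl <;> decide
  inv_mem' := by
    intro a ha
    simp only [Set.mem_insert_iff, Set.mem_singleton_iff] at ha ⊢
    rcases ha with rfl | rfl | rfl | rfl <;> decide

/-- Membership in `V₄` is membership in the explicit four-element list. [folklore] -/
theorem mem_kleinFour {v : Perm (Fin 4)} : v ∈ kleinFour ↔ v = 1 ∨ v = dt1 ∨ v = dt2 ∨ v = dt3 := Iff.rfl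

/-- `V₄ ◁ S₄`. [folklore] -/
theorem kleinFour_normal : kleinFour.Normal := ⟨by
  intro v hv g
  rw [mem_kleinFour] at hv ⊢
  rcases hv with rfl | rfl | rfl | rfl
  · simp
  · revert g; decide
  · revert g; decide
  · revert g; decide⟩

/-- `V₄ ≤ A₄`. [folklore] -/
theorem kleinFour_le_alternating : kleinFour ≤ alternatingGroup (Fin 4) := by
  intro v hv
  rw [mem_kleinFour] at hv
  rw [mem_alternatingGroup]
  rcases hv with rfl | rfl | rfl | rfl <;> decide

/-- `|V₄| = 4`. [folklore] -/
theorem card_kleinFour : Nat.card kleinFour = 4 := by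
  letI : DecidablePred (· ∈ kleinFour) := fun _ => decidable_of_iff _ mem_kleinFour.symm
  rw [Nat.card_eq_fintype_card]
  decide

/-- `[S₄ : V₄] = 6`. [folklore] -/
theorem index_kleinFour : kleinFour.index = 6 := by
  have h := kleinFour.card_mul_index
  rw [card_kleinFour, Nat.card_perm, Nat.card_eq_fintype_card, Fintype.card_fin] at h
  simp [Nat.factorial] at h
  omega

/-- `[A₄ : V₄] = 3`. [folklore] -/
theorem relIndex_kleinFour_alternating : kleinFour.relIndex (alternatingGroup (Fin 4)) = 3 := by
  have h := Subgroup.relIndex_mul_index kleinFour_le_alternating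
  rw [alternatingGroup.index_eq_two, index_kleinFour] at h
  omega

/-- If `φ : G →* Perm α` with `|α| = 4` has image the alternating group, then `G` has a normal subgroup of index `3`
(the preimage of the Klein four-group). -/
theorem exists_normal_index_three {G : Type*} [Group G] {α : Type*} [Fintype α] [DecidableEq α]
    (hα : Fintype.card α = 4) (φ : G →* Perm α) (hφ : φ.range = alternatingGroup α) :
    ∃ N : Subgroup G, N.Normal ∧ N.index = 3 := by
  set e : α ≃ Fin 4 := Fintype.equivFinOfCardEq hα with he
  set E : Perm α →* Perm (Fin 4) := e.permCongrHom.toMonoidHom with hE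
  haveI := kleinFour_normal
  refine ⟨kleinFour.comap (E.comp φ), inferInstance, ?_⟩
  rw [Subgroup.index_comap]
  have hr : (E.comp φ).range = alternatingGroup (Fin 4) := by
    rw [MonoidHom.range_comp, hφ]
    ext x
    simp only [Subgroup.mem_map, mem_alternatingGroup, hE, MulEquiv.coe_toMonoidHom]
    constructor
    · rintro ⟨y, hy, rfl⟩
      rw [Equiv.permCongrHom]
      simpa [sign_permCongr] using hy
    · intro hx
      refine ⟨e.permCongrHom.symm x, ?_, by rw [Equiv.permCongrHom_symm]; ext i; simp [Equiv.permCongrHom, Equiv.permCongr_apply]⟩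
      rw [Equiv.permCongrHom_symm, Equiv.permCongrHom]
      simpa [sign_permCongr] using hx
  rw [hr, relIndex_kleinFour_alternating]

/-- **EXTREMAL LEMMA.** A finite group with no normal subgroup of prime index (equivalently: a perfect finite group) has no subgroup of
index `2`, `3` or `4`: the coset action would map it onto a non-trivial transitive subgroup of `S₄`, all of which are solvable. -/
theorem no_subgroup_of_index_le_four {G : Type*} [Group G] [Finite G]
    (hperf : ∀ (N : Subgroup G), N.Normal → N.index.Prime → False)
    (H : Subgroup G) (h2 : 2 ≤ H.index) (h4 : H.index ≤ 4) : False := by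
  classical
  letI : Fintype (G ⧸ H) := Fintype.ofFinite _
  have hcardQ : Nat.card (G ⧸ H) = H.index := H.index_eq_card.symm
  have hcardQ' : Fintype.card (G ⧸ H) = H.index := by rw [← Nat.card_eq_fintype_card, hcardQ]
  haveI : Nontrivial (G ⧸ H) := by
    rw [← Finite.one_lt_card_iff_nontrivial, hcardQ]; omega
  set φ : G →* Perm (G ⧸ H) := MulAction.toPermHom G (G ⧸ H) with hφ
  -- the sign character is trivial
  have hsign : ∀ g, sign (φ g) = 1 := by
    by_contra hne
    push Not at hne
    obtain ⟨g, hg⟩ := hne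
    set ψ : G →* ℤˣ := (sign : Perm (G ⧸ H) →* ℤˣ).comp φ with hψ
    have hg' : ψ g = -1 := by
      rcases Int.units_eq_one_or (sign (φ g)) with h | h
      · exact absurd h hg
      · simpa [hψ] using h
    have htop : ψ.range = ⊤ := by
      rw [eq_top_iff]
      intro x _
      rcases Int.units_eq_one_or x with rfl | rfl
      · exact one_mem _
      · exact ⟨g, hg'⟩
    have hidx : ψ.ker.index = 2 := by
      rw [Subgroup.index_ker, htop, Subgroup.card_top, Nat.card_eq_fintype_card, Fintype.card_units_int]
    exact hperf ψ.ker inferInstance (hidx ▸ Nat.prime_two)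
  have hle : φ.range ≤ alternatingGroup (G ⧸ H) := by
    rintro x ⟨g, rfl⟩
    exact mem_alternatingGroup.2 (hsign g)
  have hA : Nat.card (alternatingGroup (G ⧸ H)) = (H.index).factorial / 2 := by
    rw [nat_card_alternatingGroup, hcardQ]
  set N := H.normalCore with hN
  have hNidx : N.index = Nat.card φ.range := by
    rw [hN, Subgroup.normalCore_eq_ker]; exact Subgroup.index_ker φ
  have hdvdA : N.index ∣ (H.index).factorial / 2 := by
    rw [hNidx, ← hA]; exact Subgroup.card_dvd_of_le hle
  have hdvdH : H.index ∣ N.index := Subgroup.index_dvd_of_le H.normalCore_le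
  have hs : H.index = 2 ∨ H.index = 3 ∨ H.index = 4 := by omega
  rcases hs with hs | hs | hs
  · exact hperf H (Subgroup.normal_of_index_eq_two hs) (hs ▸ Nat.prime_two)
  · rw [hs] at hdvdA hdvdH
    have h3 : N.index = 3 := Nat.dvd_antisymm (by simpa [Nat.factorial] using hdvdA) hdvdH
    exact hperf N inferInstance (h3 ▸ Nat.prime_three)
  · rw [hs] at hdvdA hdvdH hcardQ'
    have h12 : N.index ∣ 12 := by simpa [Nat.factorial] using hdvdA
    have hcases : N.index = 4 ∨ N.index = 12 := by
      have hle12 : N.index ≤ 12 := Nat.le_of_dvd (by norm_num) h12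
      obtain ⟨k, hk⟩ := hdvdH
      interval_cases h : N.index <;> omega
    rcases hcases with h4' | h12'
    · -- `G ⧸ N` has order 4: a subgroup of order 2 has index 2 and is normal
      haveI : Fact (Nat.Prime 2) := ⟨Nat.prime_two⟩
      have hcardGN : Nat.card (G ⧸ N) = 4 := by rw [← N.index_eq_card, h4']
      obtain ⟨P, hP⟩ := Sylow.exists_subgroup_card_pow_prime 2 (n := 1) (G := G ⧸ N) (by rw [hcardGN]; norm_num)
      have hPi : P.index = 2 := by
        have := P.card_mul_index; rw [hP, hcardGN] at this; omega
      haveI : P.Normal := Subgroup.normal_of_index_eq_two hPi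
      have hidx : (P.comap (QuotientGroup.mk' N)).index = 2 := by
        rw [P.index_comap_of_surjective (QuotientGroup.mk'_surjective N), hPi]
      exact hperf _ inferInstance (hidx ▸ Nat.prime_two)
    · -- the image is the whole alternating group: pull back the Klein four-group
      have hrange : φ.range = alternatingGroup (G ⧸ H) := by
        haveI : Finite (alternatingGroup (G ⧸ H)) := inferInstance
        refine Subgroup.eq_of_le_of_card_ge hle (le_of_eq ?_)
        rw [hA, ← hNidx, h12', hs]; decide
      obtain ⟨N', hN'n, hN'i⟩ := exists_normal_index_three hcardQ' φ hrange
      exact hperf N' hN'n (hN'i ▸ Nat.prime_three)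

/-- **Galois corollary of the extremal lemma**: inside a Galois layer `L/K` of number fields WITHOUT cyclic sub-layers of prime degree there is
no intermediate field `K < F ≤ L` with `[F:K] ≤ 4`. -/
theorem no_intermediateField_of_finrank_le_four {K L : Type} [Field K] [NumberField K] [Field L] [NumberField L] [Algebra K L]
    [IsGalois K L]
    (hnc : ¬ ∃ F : IntermediateField K L, F ≠ ⊥ ∧ IsGalois K ↥F ∧ IsCyclic (↥F ≃ₐ[K] ↥F) ∧ (Module.finrank K ↥F).Prime)
    (F : IntermediateField K L) (hF : F ≠ ⊥) (h4 : Module.finrank K ↥F ≤ 4) : False := by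
  haveI : FiniteDimensional K L := Module.Finite.of_restrictScalars_finite ℚ K L
  have hidx : Module.finrank K ↥F = F.fixingSubgroup.index := IntermediateField.finrank_eq_fixingSubgroup_index F
  have h1 : Module.finrank K ↥F ≠ 1 := fun h => hF (IntermediateField.finrank_eq_one_iff.mp h)
  have hpos : 0 < Module.finrank K ↥F := Module.finrank_pos
  exact no_subgroup_of_index_le_four
    (fun N hN hp => by haveI := hN; exact no_normal_subgroup_of_prime_index hnc N hp)
    F.fixingSubgroup (by omega) (by omega)

/-! ## §2 The Clifford action of `Γ_K` on the centre of the commutant of an invariant representation (change-of-frame algebra) -/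

section Action

variable {K L : Type} [Field K] [NumberField K] [Field L] [NumberField L] [Algebra K L] [IsGalois K L]
variable {ℓ : ℕ} [Fact ℓ.Prime] {n : ℕ}

/-- `f` commutes with the image of `r` (the COMMUTANT `C(r)`, as a predicate on matrices). -/
def IsCommutant (r : FramedGaloisRep L (PadicAlgCl ℓ) n) (f : Matrix (Fin n) (Fin n) (PadicAlgCl ℓ)) : Prop :=
  ∀ σ : Field.absoluteGaloisGroup L,
    f * ((r σ : GL (Fin n) (PadicAlgCl ℓ)) : Matrix (Fin n) (Fin n) (PadicAlgCl ℓ)) =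
      ((r σ : GL (Fin n) (PadicAlgCl ℓ)) : Matrix (Fin n) (Fin n) (PadicAlgCl ℓ)) * f

/-- `f` lies in the CENTRE `Z(C(r))` of the commutant. -/
def IsCentral (r : FramedGaloisRep L (PadicAlgCl ℓ) n) (f : Matrix (Fin n) (Fin n) (PadicAlgCl ℓ)) : Prop :=
  IsCommutant r f ∧ ∀ f' : Matrix (Fin n) (Fin n) (PadicAlgCl ℓ), IsCommutant r f' → f * f' = f' * f

/-- `P` INTERTWINES the `τ`-conjugate of `r` with `r`: `P · r^τ · P⁻¹ = r`. -/
def IsIntertwiner (r : FramedGaloisRep L (PadicAlgCl ℓ) n) (τ : Field.absoluteGaloisGroup K)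
    (P : GL (Fin n) (PadicAlgCl ℓ)) : Prop :=
  FramedRep.conj P (FramedGaloisRep.outerConj τ r) = r

/-- Conjugating two commuting elements by a unit gives commuting elements. [folklore] -/
theorem units_conj_comm {R : Type*} [Ring R] (P : Rˣ) {f x : R} (h : f * x = x * f) :
    (↑P * f * ↑P⁻¹) * (↑P * x * ↑P⁻¹) = (↑P * x * ↑P⁻¹) * (↑P * f * ↑P⁻¹) := by
  simp only [mul_assoc, Units.inv_mul_cancel_left]
  rw [← mul_assoc f x, h]
  simp only [mul_assoc]

/-- The same with `P⁻¹ · _ · P`. [folklore] -/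
theorem units_conj_comm' {R : Type*} [Ring R] (P : Rˣ) {f x : R} (h : f * x = x * f) :
    (↑P⁻¹ * f * ↑P) * (↑P⁻¹ * x * ↑P) = (↑P⁻¹ * x * ↑P) * (↑P⁻¹ * f * ↑P) := by
  have := units_conj_comm P⁻¹ h
  simpa only [inv_inv] using this

/-- Conjugation by `P · c` agrees with conjugation by `P` on elements commuting with `c`. [folklore] -/
theorem units_conj_eq_of_comm {R : Type*} [Ring R] (P c : Rˣ) {f : R} (h : f * ↑c = ↑c * f) :
    (↑(P * c) : R) * f * ↑(P * c)⁻¹ = ↑P * f * ↑P⁻¹ := by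
  rw [mul_inv_rev, Units.val_mul, Units.val_mul]
  simp only [mul_assoc]
  rw [← mul_assoc (↑c : R) f, ← h, mul_assoc, Units.mul_inv_cancel_left]

variable {r : FramedGaloisRep L (PadicAlgCl ℓ) n} {τ : Field.absoluteGaloisGroup K} {P P' : GL (Fin n) (PadicAlgCl ℓ)}
variable {f : Matrix (Fin n) (Fin n) (PadicAlgCl ℓ)}

/-- An intertwiner rewrites `r(σ)` as `P · r(θ_τ σ) · P⁻¹` (matrices). -/
theorem coe_apply_eq_of_isIntertwiner (h : IsIntertwiner r τ P) (σ : Field.absoluteGaloisGroup L) :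
    ((r σ : GL (Fin n) (PadicAlgCl ℓ)) : Matrix (Fin n) (Fin n) (PadicAlgCl ℓ)) =
      (P : Matrix (Fin n) (Fin n) (PadicAlgCl ℓ)) *
        ((r (absGaloisOuterConj K L τ σ) : GL (Fin n) (PadicAlgCl ℓ)) : Matrix (Fin n) (Fin n) (PadicAlgCl ℓ)) *
        ((P⁻¹ : GL (Fin n) (PadicAlgCl ℓ)) : Matrix (Fin n) (Fin n) (PadicAlgCl ℓ)) := by
  have h' := congrArg (fun ρ : FramedGaloisRep L (PadicAlgCl ℓ) n =>
    ((ρ σ : GL (Fin n) (PadicAlgCl ℓ)) : Matrix (Fin n) (Fin n) (PadicAlgCl ℓ))) h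
  simp only [FramedRep.conj_apply, FramedGaloisRep.outerConj_apply, Units.val_mul] at h'
  exact h'.symm

/-- … equivalently `r(θ_τ σ) = P⁻¹ · r(σ) · P`. -/
theorem coe_apply_outerConj_eq_of_isIntertwiner (h : IsIntertwiner r τ P) (σ : Field.absoluteGaloisGroup L) :
    ((r (absGaloisOuterConj K L τ σ) : GL (Fin n) (PadicAlgCl ℓ)) : Matrix (Fin n) (Fin n) (PadicAlgCl ℓ)) =
      ((P⁻¹ : GL (Fin n) (PadicAlgCl ℓ)) : Matrix (Fin n) (Fin n) (PadicAlgCl ℓ)) *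
        ((r σ : GL (Fin n) (PadicAlgCl ℓ)) : Matrix (Fin n) (Fin n) (PadicAlgCl ℓ)) *
        (P : Matrix (Fin n) (Fin n) (PadicAlgCl ℓ)) := by
  rw [coe_apply_eq_of_isIntertwiner h σ]
  simp [mul_assoc]

/-- The Clifford action preserves the commutant: `f ∈ C(r) ⇒ P f P⁻¹ ∈ C(r)`. [ref: Clifford1937, §1] -/
theorem isCommutant_conj (h : IsIntertwiner r τ P) (hf : IsCommutant r f) :
    IsCommutant r ((P : Matrix (Fin n) (Fin n) (PadicAlgCl ℓ)) * f * ((P⁻¹ : GL (Fin n) (PadicAlgCl ℓ)) : Matrix (Fin n) (Fin n) (PadicAlgCl ℓ))) := by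
  intro σ
  rw [coe_apply_eq_of_isIntertwiner h σ]
  exact units_conj_comm P (hf _)

/-- … and so does the inverse frame change: `f ∈ C(r) ⇒ P⁻¹ f P ∈ C(r)` (uses that `θ_τ` is onto). [ref: Clifford1937, §1] -/
theorem isCommutant_conj_inv (h : IsIntertwiner r τ P) (hf : IsCommutant r f) :
    IsCommutant r (((P⁻¹ : GL (Fin n) (PadicAlgCl ℓ)) : Matrix (Fin n) (Fin n) (PadicAlgCl ℓ)) * f * (P : Matrix (Fin n) (Fin n) (PadicAlgCl ℓ))) := by
  intro σ'
  obtain ⟨σ, rfl⟩ := (absGaloisOuterConj_bijective K L τ).2 σ'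
  rw [coe_apply_outerConj_eq_of_isIntertwiner h σ]
  exact units_conj_comm' P (hf _)

/-- The Clifford action preserves the CENTRE of the commutant. [ref: Clifford1937, §1] -/
theorem isCentral_conj (h : IsIntertwiner r τ P) (hf : IsCentral r f) :
    IsCentral r ((P : Matrix (Fin n) (Fin n) (PadicAlgCl ℓ)) * f * ((P⁻¹ : GL (Fin n) (PadicAlgCl ℓ)) : Matrix (Fin n) (Fin n) (PadicAlgCl ℓ))) := by
  refine ⟨isCommutant_conj h hf.1, fun f' hf' => ?_⟩
  have hc := hf.2 _ (isCommutant_conj_inv h hf')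
  have key := units_conj_comm P hc
  simpa only [mul_assoc, Units.mul_inv_cancel_left, Units.inv_mul_cancel_left, Units.mul_inv, mul_one] using key

/-- On the centre of the commutant the action of `τ` does NOT depend on the intertwiner chosen. [ref: Clifford1937, §2] -/
theorem act_eq_of_isIntertwiner (h : IsIntertwiner r τ P) (h' : IsIntertwiner r τ P') (hf : IsCentral r f) :
    (P : Matrix (Fin n) (Fin n) (PadicAlgCl ℓ)) * f * ((P⁻¹ : GL (Fin n) (PadicAlgCl ℓ)) : Matrix (Fin n) (Fin n) (PadicAlgCl ℓ)) =
      (P' : Matrix (Fin n) (Fin n) (PadicAlgCl ℓ)) * f * ((P'⁻¹ : GL (Fin n) (PadicAlgCl ℓ)) : Matrix (Fin n) (Fin n) (PadicAlgCl ℓ)) := by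
  have hc : IsCommutant r (((P⁻¹ * P' : GL (Fin n) (PadicAlgCl ℓ)) : Matrix (Fin n) (Fin n) (PadicAlgCl ℓ))) := by
    intro σ'
    obtain ⟨σ, rfl⟩ := (absGaloisOuterConj_bijective K L τ).2 σ'
    have E := (coe_apply_eq_of_isIntertwiner h σ).symm.trans (coe_apply_eq_of_isIntertwiner h' σ)
    have E' := congrArg (fun y => ((P⁻¹ : GL (Fin n) (PadicAlgCl ℓ)) : Matrix (Fin n) (Fin n) (PadicAlgCl ℓ)) * y *
      (P' : Matrix (Fin n) (Fin n) (PadicAlgCl ℓ))) E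
    simp only [Units.val_mul, mul_assoc, Units.inv_mul_cancel_left, Units.inv_mul, mul_one] at E' ⊢
    exact E'.symm
  have hfc := hf.2 _ hc
  have key := units_conj_eq_of_comm P (P⁻¹ * P') hfc
  rw [mul_inv_cancel_left] at key
  exact key.symm

/-- The action of `res Γ_L` on the centre of the commutant is trivial. [ref: Clifford1937, §2] -/
theorem act_eq_self_of_absGaloisRestrict (σ₀ : Field.absoluteGaloisGroup L)
    (h : IsIntertwiner r (absGaloisRestrict K L σ₀) P) (hf : IsCentral r f) :
    (P : Matrix (Fin n) (Fin n) (PadicAlgCl ℓ)) * f * ((P⁻¹ : GL (Fin n) (PadicAlgCl ℓ)) : Matrix (Fin n) (Fin n) (PadicAlgCl ℓ)) = f := by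
  have h₀ : IsIntertwiner r (absGaloisRestrict K L σ₀) (r σ₀)⁻¹ := by
    unfold IsIntertwiner
    rw [FramedGaloisRep.outerConj_absGaloisRestrict, conj_conj, inv_mul_cancel (r σ₀), conj_one]
  rw [act_eq_of_isIntertwiner h h₀ hf, inv_inv, mul_assoc, hf.1 σ₀, ← mul_assoc, Units.inv_mul, one_mul]

/-- Intertwiners EXIST for the relative avatar of `π` across a Galois layer (tree `relAvatar_invariant`: Chebotarev + Brauer–Nesbitt). -/
theorem isIntertwiner_exists {hcpt : isCompact_glFiniteIntegralLevel n K}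
    (π : CuspidalAutomorphicRepData n K hcpt) (ι : PadicAlgCl ℓ ≃+* ℂ)
    (r : FramedGaloisRep L (PadicAlgCl ℓ) n) (hr : r.toGaloisRep.IsSemisimple)
    (hrel : (∀ᶠ w : IsDedekindDomain.HeightOneSpectrum (NumberField.RingOfIntegers L) in cofinite, ∀ (v : IsDedekindDomain.HeightOneSpectrum (NumberField.RingOfIntegers K)) (α : Multiset ℂ), w.asIdeal.under (NumberField.RingOfIntegers K) = v.asIdeal → π.1.HasSatakeParamAt v α → r.IsUnramifiedAt w ∧ r.HasFrobCharpolyAt w (Literature.NumberTheory.Automorphic.arithFrobPolyOfSatake ι w.residueCard 1 (α.map (fun a => a ^ w.asIdeal.inertiaDeg (NumberField.RingOfIntegers K))))))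
    (τ : Field.absoluteGaloisGroup K) : ∃ P : GL (Fin n) (PadicAlgCl ℓ), IsIntertwiner r τ P :=
  relAvatar_invariant π.1 ι r hr hrel τ

/-- KRON and MOV are disjoint: a scalar central element is never moved. -/
theorem not_moved_of_isotypic
    (hiso : ∀ f : Matrix (Fin n) (Fin n) (PadicAlgCl ℓ), IsCentral r f →
      f ∈ Set.range (Matrix.scalar (Fin n) : PadicAlgCl ℓ → Matrix (Fin n) (Fin n) (PadicAlgCl ℓ)))
    (hf : IsCentral r f) (P : GL (Fin n) (PadicAlgCl ℓ)) :
    (P : Matrix (Fin n) (Fin n) (PadicAlgCl ℓ)) * f * ((P⁻¹ : GL (Fin n) (PadicAlgCl ℓ)) : Matrix (Fin n) (Fin n) (PadicAlgCl ℓ)) = f := by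
  obtain ⟨c, rfl⟩ := hiso f hf
  have hc : Commute (Matrix.scalar (Fin n) c) (P : Matrix (Fin n) (Fin n) (PadicAlgCl ℓ)) :=
    Matrix.scalar_commute c (fun c' => Commute.all c c') _
  rw [← hc.eq, mul_assoc, Units.mul_inv, mul_one]

end Action

end Summit.Langlands.Langlands.Theorems.CliffordOrbitSplit
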